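import Summits.HodgeConjecture.HodgeConjecture.Theorems.Ring2HypothesesGeneralFibre
import Summits.HodgeConjecture.HodgeConjecture.Theorems.Ring2DeformPrintedFamilies
import Literature.AlgebraicGeometry.HodgeTheory.HodgeConjectureIsogenyInvariance
import Literature.AlgebraicGeometry.HodgeTheory.HodgeGroupProductCMFactorClasses
import HarnessLib

/-!
# Ring 2 · route `deform`, VII — ROW U LOCALISED: the input of the deformation axis PER VARIETY
# and PER CLASS (`CMSpreadingAt A`, `CMSpreadingOn 𝒞`); row U distributes over the atlas

**Honest framing (verbatim, carried on every Ring-2 artefact).** This is a *research route conditional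
on `HC_CM`; not a corollary; Q11.4-sentence-2 already refuted in dim ≥ 3*. `HC_CM` (the Hodge
conjecture for CM abelian varieties, item `stmt-HodgeConjecture-3052`, decl
`Theses.RankFourFaces.CMAbelianHodge`) enters below only as a binder `(hCM : HC_CM)`, never as a fact.
Nothing in this file proves a case of the Hodge conjecture.

**What parts I–VI settled.** Modulo `HC_CM` and Deligne's CM-density fact #20
(`deligne1982_cmDenseMumfordTateFamilies`) the deformation axis has exactly one honest complementary
input, row U = `UniformAlgebraicityAtCMPoints` ("in a CM-dense Mumford–Tate family of abelian varieties a
class algebraic at every CM fibre is algebraic at every fibre"): `HC_AV ↔ HC_CM ∧ U` and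
`CMToAbelian ↔ (HC_CM → U)` (parts II-b, III). Row U is a statement about ALL families at once.

**What this part adds (the atlas service).** The cell's atlas (`data/atlas/atlas.tsv`) lists classes `𝒞`
of abelian varieties (isogeny / Mumford–Tate cells) and asks, per cell, which deformation-theoretic input
closes `HC` on the cell modulo `HC_CM`. The answer is the LOCALISATION of row U at a variety:

* `CMSpreadingTo f n s₁` (§A): on the family `f`, every global class that is fibrewise a rational
  `(p,p)`-class and algebraic at every CM fibre is algebraic AT THE FIBRE `s₁`;
* `CMSpreadingAt A` (§A): `CMSpreadingTo f A.dim s₁` for every U-admissible CM-dense family `f` through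
  `A = 𝒳_{s₁}` (the binders of row U, verbatim, plus the chart `A.X ≅ 𝒳_{s₁}`).

Then (all kernel-checked, `HC_CM` a binder):

* per family (§B): `Dense (CM locus) → (UniformAlgebraicityOn f n ↔ ∀ s₁, CMSpreadingTo f n s₁)`; the
  invariant-cycles property (1.1) and typer 2's `H4 = AlgebraicityLocusClosedOn` each give it;
* per variety (§C): `HC(A) → CMSpreadingAt A` UNCONDITIONALLY (on path), and
  `HC_CM → #20 → (HC(A) ↔ CMSpreadingAt A)`; CM varieties, divisor-generated (`B = D`) varieties and
  `dim ≤ 3` satisfy `CMSpreadingAt` for free; it is an isogeny invariant modulo `HC_CM`;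
* ROW U IS LOCAL IN THE VARIETY (§C): `UniformAlgebraicityAtCMPoints ↔ ∀ A, CMSpreadingAt A` — with NO
  hypothesis — so row U distributes over any cover of the class of abelian varieties by cells (§D);
* per class (§D): for every `𝒞`, `HC_CM → #20 → (HCOnClass 𝒞 ↔ CMSpreadingOn 𝒞)` where
  `HCOnClass 𝒞 := ∀ A, 𝒞 A → HodgeConjectureFor A.dim A.X` is typer 1's frame
  (`ClassTargets.HCOnClass`, spelled out here literally; the identification is `ClassTargets.hcOnClass_iff`,
  `Iff.rfl`) and `CMSpreadingOn 𝒞 := ∀ A, 𝒞 A → CMSpreadingAt A`; with the CM column adjoined the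
  statement is EXACT without the binder: `HCOnClass (𝒞 ∪ CM) ↔ HC_CM ∧ CMSpreadingOn 𝒞` (mod #20);
* re-derived deciding readings: `HC_AV ↔ HC_CM ∧ ∀ A, CMSpreadingAt A`, `CMToAbelian ↔ (HC_CM → ∀ A,
  CMSpreadingAt A)` (mod #20), consistent with parts II-b/III.

**Reading for the atlas columns (c6)/(c7).** For a cell `𝒞`: (c6) the deformation input is
`CMSpreadingOn 𝒞` — row U restricted to the Mumford–Tate families through members of the cell, localised
at the member; (c7) its KIND: on CM cells it is VACUOUS (`cmSpreadingAt_of_isOfCMType`: there `HC_CM` is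
the whole content, by definition); on cells with no exceptional Hodge classes (`B = D`) it is FREE
(`cmSpreadingAt_of_isDivisorGenerated`), as on `dim ≤ 3`; on every other cell it is of KIND 2
(complementary: `HCOnClass 𝒞 → CMSpreadingOn 𝒞` holds unconditionally, so the input is NECESSARY, and it
is not a consequence of `HC_CM` by any theorem in print — Deligne's Principle B transports absolute
Hodge-ness, not algebraicity, [Deligne 1982, Thm. 2.12 vs. Prop. 2.9; Charles–Schnell 2014, §11.1]).

`CMSpreadingTo` / `CMSpreadingAt` are predicates WITH PARAMETERS (like typer 1's `HCOnClass`, typer 2's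
`UniformAlgebraicityOn`), not closed conjecture nodes; no `@[conjecture]` node is added in this part.

Sources: [Deligne 1982, Thm. 2.11–2.12, Prop. 2.9, §5 Thm. 5.3, §6 Prop. 6.1, pp. 71–73];
[Charles–Schnell 2014 = arXiv:1101.3647 / Princeton Math. Notes 49 Ch. 11, Thm. 11.3.2, Prop. 11.3.11 (= Thm. 38),
§11.3.4 Def. 43 / Cor. 44, Thm. 11.5.11]; [Abdulali 1994, Lemma 6.2 (p. 1131)]; [André 1996, §0.2 "n'est
pas stable par déformation"]; [van Geemen 1994, §2.4, Lemma 3.7]; [Milne 1999, §7 (H)]; [Deligne 2000, §1].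
-/

set_option linter.dupNamespace false

noncomputable section

namespace Summit.HodgeConjecture.HodgeConjecture.Ring2.Deform

open CategoryTheory AlgebraicGeometry
open Literature.AlgebraicGeometry Literature.AlgebraicGeometry.Motives
open Literature.AlgebraicGeometry.HodgeTheory
open Literature.AlgebraicGeometry.Milne1999 (IsOfCMType)
open Literature.AlgebraicGeometry.Abdulali1994 (InvariantCyclesHoldFor)
open Literature.AlgebraicGeometry.Deligne1982 (deligne1982_cmDenseMumfordTateFamilies
  IsCMDenseMumfordTateFamilyFor)
open Summit.HodgeConjecture.HodgeConjecture
open Summit.HodgeConjecture.HodgeConjecture.Theses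
open Summit.HodgeConjecture.HodgeConjecture.Ring2.Hypotheses (anchorLocus mem_anchorLocus_iff
  UniformAlgebraicityOn AlgebraicityLocusClosedOn hodgeConjectureFor_iff_of_iso
  uniformAlgebraicityOn_of_algebraicityLocusClosedOn uniformAlgebraicityOn_of_uniformAlgebraicityAtCMPoints)

variable {𝒳 S : SchemeOver ℂ}

/-! ## §A — The localised input -/

/-- **`CMSpreadingTo f n s₁` — algebraicity spreads from the CM fibres of `f` to the fibre at `s₁`.**
For every `p` and every global class `W ∈ H^{2p}(𝒳(ℂ), ℂ)` whose fibre restrictions `W_s` are rational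
`(p,p)`-classes at every fibre and algebraic at every CM fibre (`s ∈ cmLocus f n`), the restriction
`W_{s₁}` is algebraic on `𝒳_{s₁}`. This is row U of the axis (`UniformAlgebraicityOn f n`, "a closed
analytic stratum containing the CM locus carries algebraicity") read at ONE fibre (§B makes the two
equivalent over a CM-dense base). It is the algebraic — not absolute-Hodge — version of Deligne's
Principle B at the point `s₁`, which is exactly what Principle B does not give.
[cite: Deligne1982HodgeCycles, Thm. 2.12 and Prop. 2.9] [cite: CharlesSchnell2014Notes, Thm. 11.3.2, Prop. 11.3.11, §11.1] -/
def CMSpreadingTo (f : 𝒳 ⟶ S) (n : ℕ) (s₁ : ComplexPoints S) : Prop :=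
  ∀ (p : ℕ) (W : complexBetti 𝒳 (2 * p)),
    (∀ s : ComplexPoints S, IsRationalClass (complexBetti.map (fiberι f s) (2 * p) W) ∧
      IsOfHodgeType n (fiberOver f s) (2 * p) p p (complexBetti.map (fiberι f s) (2 * p) W)) →
    (∀ s ∈ cmLocus f n, complexBetti.map (fiberι f s) (2 * p) W ∈ algebraicClasses (fiberOver f s) p) →
    complexBetti.map (fiberι f s₁) (2 * p) W ∈ algebraicClasses (fiberOver f s₁) p

/-- **`CMSpreadingAt A` — row U localised at the abelian variety `A`.** For every smooth projective
family `f : 𝒳 → S` of abelian varieties of dimension `A.dim` over a smooth irreducible quasi-projective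
base with DENSE CM locus (the binders of row U = `UniformAlgebraicityAtCMPoints`, verbatim) and every
point `s₁` with a chart `A.X ≅ 𝒳_{s₁}`, algebraicity spreads from the CM fibres to the fibre `A`:
`CMSpreadingTo f A.dim s₁`. The families that matter are the Mumford–Tate families through `A` produced
by Deligne's fact #20; quantifying over all admissible families keeps the statement free of that
construction. [cite: Deligne1982HodgeCycles, §5 Thm. 5.3, §6 Prop. 6.1 (pp. 71–73)]
[cite: CharlesSchnell2014Notes, Thm. 11.5.11, Prop. 11.3.11] -/
def CMSpreadingAt (A : AbelianVariety ℂ) : Prop :=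
  ∀ ⦃𝒳 S : SchemeOver ℂ⦄ (f : 𝒳 ⟶ S) (s₁ : ComplexPoints S), Nonempty (A.X ≅ fiberOver f s₁) →
    IsSmoothProjectiveFamily f A.dim → IsQuasiProjectiveOver 𝒳 → IsQuasiProjectiveOver S →
    IrreducibleSpace S.left → AlgebraicGeometry.Smooth S.hom →
    (∀ s : ComplexPoints S, ∃ A' : AbelianVariety ℂ, A'.dim = A.dim ∧ Nonempty (A'.X ≅ fiberOver f s)) →
    Dense (cmLocus f A.dim) → CMSpreadingTo f A.dim s₁

/-! ## §B — Per family: `CMSpreadingTo` versus row U, (1.1) and H4 -/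
/-- At a CM fibre the localised input is tautological. [folklore] -/
theorem cmSpreadingTo_of_mem_cmLocus {f : 𝒳 ⟶ S} {n : ℕ} {s : ComplexPoints S}
    (hs : s ∈ cmLocus f n) : CMSpreadingTo f n s :=
  fun _ _ _ hcm => hcm s hs

/-- At an ANCHOR fibre (one where the Hodge conjecture holds) the localised input holds outright: the
fibre class is a rational `(p,p)`-class, hence algebraic. [cite: Abdulali1994FamiliesAV, proof of Lemma 6.2 (p. 1131)] -/
theorem cmSpreadingTo_of_mem_anchorLocus {f : 𝒳 ⟶ S} {n : ℕ} {s : ComplexPoints S}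
    (hs : s ∈ anchorLocus f n) : CMSpreadingTo f n s :=
  fun p _ hW _ => ((mem_anchorLocus_iff f n s).1 hs).2 p _ (hW s).1 (hW s).2

/-- **Row U on a CM-dense family gives the localised input at every fibre**: the closed analytic stratum
of row U contains the dense CM locus, hence is everything (part II-a,
`forall_mem_algebraicClasses_of_dense_of_subset_closed`).
[cite: CharlesSchnell2014Notes, Prop. 11.3.11, §11.3.4 Cor. 44] -/
theorem cmSpreadingTo_of_uniformAlgebraicityOn {f : 𝒳 ⟶ S} {n : ℕ} (hD : Dense (cmLocus f n))
    (hU : UniformAlgebraicityOn f n) (s₁ : ComplexPoints S) : CMSpreadingTo f n s₁ := by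
  intro p W hW hcm
  obtain ⟨W₀, hW₀c, hW₀alg, hcmW₀⟩ := hU p W hW hcm
  exact forall_mem_algebraicClasses_of_dense_of_subset_closed f hD hW₀c hW₀alg hcmW₀ s₁

/-- **Conversely the localised input at every fibre gives row U** (take the whole base as the closed
stratum; part II-a, `exists_closed_stratum_of_forall`). No density needed. [folklore] -/
theorem uniformAlgebraicityOn_of_forall_cmSpreadingTo {f : 𝒳 ⟶ S} {n : ℕ}
    (h : ∀ s₁ : ComplexPoints S, CMSpreadingTo f n s₁) : UniformAlgebraicityOn f n :=
  fun p W hW hcm => exists_closed_stratum_of_forall f (fun t => h t p W hW hcm) _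

/-- **Per family, over a CM-dense base, row U = the localised input at every fibre.**
[cite: CharlesSchnell2014Notes, Prop. 11.3.11] -/
theorem uniformAlgebraicityOn_iff_forall_cmSpreadingTo {f : 𝒳 ⟶ S} {n : ℕ}
    (hD : Dense (cmLocus f n)) :
    UniformAlgebraicityOn f n ↔ ∀ s₁ : ComplexPoints S, CMSpreadingTo f n s₁ :=
  ⟨fun hU => cmSpreadingTo_of_uniformAlgebraicityOn hD hU,
    uniformAlgebraicityOn_of_forall_cmSpreadingTo⟩

/-- **The invariant-cycles property (1.1) gives the localised input at every fibre** as soon as ONE CM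
fibre exists (the CM fibre is where (1.1)'s "algebraic at some point" is fed).
[cite: Abdulali1994FamiliesAV, (1.1) and Lemma 6.2] [cite: CharlesSchnell2014Notes, Conj. 11.3.1] -/
theorem cmSpreadingTo_of_invariantCyclesHoldFor {f : 𝒳 ⟶ S} {n : ℕ}
    (hIC : InvariantCyclesHoldFor f n) (hne : (cmLocus f n).Nonempty) (s₁ : ComplexPoints S) :
    CMSpreadingTo f n s₁ := by
  intro p W hW hcm
  obtain ⟨s₀, hs₀⟩ := hne
  exact hIC p W hW ⟨s₀, hcm s₀ hs₀⟩ s₁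

/-- **Typer 2's H4 (`AlgebraicityLocusClosedOn`: algebraicity loci of fibrewise-Hodge global classes
are analytically closed) gives the localised input at every fibre of a CM-dense family.**
[cite: CharlesSchnell2014Notes, §11.3.4 Def. 43, Cor. 44, Thm. 11.1.4] -/
theorem cmSpreadingTo_of_algebraicityLocusClosedOn {f : 𝒳 ⟶ S} {n : ℕ}
    (hD : Dense (cmLocus f n)) (hH4 : AlgebraicityLocusClosedOn f n) (s₁ : ComplexPoints S) :
    CMSpreadingTo f n s₁ :=
  cmSpreadingTo_of_uniformAlgebraicityOn hD (uniformAlgebraicityOn_of_algebraicityLocusClosedOn hD hH4) s₁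

/-! ## §C — Per variety: `CMSpreadingAt A` versus `HC(A)`; row U is local in the variety -/
/-- **ON PATH, per variety, unconditionally**: the Hodge conjecture for `A` gives `CMSpreadingAt A`
(transport `HC` to the fibre along the chart; the fibre is then an anchor). So the localised input is
NECESSARY for `HC(A)` — a genuine KIND-2 (complementary) input, never stronger than the target.
[cite: Deligne2000, §1] [cite: Abdulali1994FamiliesAV, proof of Lemma 6.2] -/
theorem cmSpreadingAt_of_hodgeConjectureFor {A : AbelianVariety ℂ}
    (h : HodgeConjectureFor A.dim A.X) : CMSpreadingAt A := by
  intro 𝒳 S f s₁ he _ _ _ _ _ _ _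
  obtain ⟨e⟩ := he
  exact cmSpreadingTo_of_mem_anchorLocus
    ((mem_anchorLocus_iff f A.dim s₁).2 ((hodgeConjectureFor_iff_of_iso e).1 h))

/-- **CM column: the localised input is VACUOUS on CM abelian varieties** — the point `s₁` is itself in
the CM locus. No `HC_CM` is used: on a CM cell of the atlas the deformation input is empty and `HC_CM`
is the entire content of `HC` there (typer 1, `ClassTargets.hcOnClass_cmType_iff_cmAbelianHodge`).
[cite: Milne1999, §7 (H)] [cite: Deligne1982HodgeCycles, §5 Thm. 5.3] -/
theorem cmSpreadingAt_of_isOfCMType {A : AbelianVariety ℂ} (hA : IsOfCMType A) : CMSpreadingAt A :=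
  fun _ _ _ _ he _ _ _ _ _ _ _ => cmSpreadingTo_of_mem_cmLocus ⟨A, he, rfl, hA⟩

/-- **`B = D` cells: the localised input is FREE on divisor-generated abelian varieties** (there `HC(A)`
is a theorem of the tree, `hodgeConjectureFor_of_isDivisorGenerated`). This is the atlas's
"no exceptional classes" column. [cite: vanGeemen1994HodgeAV, §2.4] -/
theorem cmSpreadingAt_of_isDivisorGenerated {A : AbelianVariety ℂ} (hD : IsDivisorGenerated A) :
    CMSpreadingAt A :=
  cmSpreadingAt_of_hodgeConjectureFor (hodgeConjectureFor_of_isDivisorGenerated A hD)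

/-- **`dim A ≤ 3`: the localised input is FREE** (Lefschetz `(1,1)` + hard Lefschetz, tree theorem
`hodgeConjectureFor_of_dim_le_three_holds`). [cite: VoisinHodgeII2003, §10.2.3 proof of Prop. 10.26] -/
theorem cmSpreadingAt_of_dim_le_three {A : AbelianVariety ℂ} (hA : A.dim ≤ 3) : CMSpreadingAt A :=
  cmSpreadingAt_of_hodgeConjectureFor
    (hodgeConjectureFor_of_dim_le_three_holds hA (AbelianVariety.isSmoothProjective_holds (A := A)))

/-- **The conditional theorem per variety: `HC_CM → #20 → CMSpreadingAt A → HC(A)`.** Given a rational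
`(p,p)`-class `c` on `A`, Deligne's fact #20 puts `A` in a CM-dense Mumford–Tate family with `c`
extended to a fibrewise-Hodge global class `W`; `HC_CM` (binder) makes `W` algebraic at every CM fibre;
the localised input at `A`'s own fibre makes `W_{s₁} = c` algebraic. `HC_CM` is used at the CM fibres
ONLY. [cite: Deligne1982HodgeCycles, §6 Prop. 6.1, main Thm. 2.11 (pp. 71–73)]
[cite: CharlesSchnell2014Notes, Thm. 11.5.11 and its proof] -/
theorem hodgeConjectureFor_of_HC_CM_of_cmSpreadingAt (hCM : RankFourFaces.CMAbelianHodge)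
    (hF : deligne1982_cmDenseMumfordTateFamilies) {A : AbelianVariety ℂ} (h : CMSpreadingAt A) :
    HodgeConjectureFor A.dim A.X := by
  refine (hodgeConjectureFor_iff_of_isSmoothProjective nonempty_hodgeModel_holds
    (AbelianVariety.isSmoothProjective_holds (A := A))).2 ?_
  intro p c hc hpp
  obtain ⟨𝒳, S, f, s₁, e, W, hf, h𝒳, hS, hirr, hsm, hab, hW, hWc, hD⟩ :=
    hF A (AbelianVariety.isSmoothProjective_holds (A := A)) p c hc hpp
  rw [← hWc]
  exact (mem_algebraicClasses_map_iff_of_iso e).2 (h f s₁ ⟨e⟩ hf h𝒳 hS hirr hsm hab hD p W hW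
    (forall_cmLocus_mem_algebraicClasses_of_HC_CM hCM f W hW))

/-- **EXACTNESS per variety modulo `HC_CM` and #20: `HC(A) ↔ CMSpreadingAt A`.**
[cite: Deligne1982HodgeCycles, §6 Prop. 6.1] [cite: CharlesSchnell2014Notes, Thm. 11.5.11, Prop. 11.3.11] -/
theorem hodgeConjectureFor_iff_cmSpreadingAt_of_HC_CM (hCM : RankFourFaces.CMAbelianHodge)
    (hF : deligne1982_cmDenseMumfordTateFamilies) (A : AbelianVariety ℂ) :
    HodgeConjectureFor A.dim A.X ↔ CMSpreadingAt A :=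
  ⟨cmSpreadingAt_of_hodgeConjectureFor, hodgeConjectureFor_of_HC_CM_of_cmSpreadingAt hCM hF⟩

/-- **Isogeny invariance modulo `HC_CM`** (van Geemen's Lemma 3.7 through the exactness): the localised
input descends along isogenies, so it is a function of the atlas's isogeny cells.
[cite: vanGeemen1994HodgeAV, §3.5–3.7 Lemma 3.7 (p. 236)] -/
theorem cmSpreadingAt_of_isIsogenous_of_HC_CM (hCM : RankFourFaces.CMAbelianHodge)
    (hF : deligne1982_cmDenseMumfordTateFamilies) {A B : AbelianVariety ℂ}
    (hAB : AbelianVariety.IsIsogenous A B) (hB : CMSpreadingAt B) : CMSpreadingAt A :=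
  cmSpreadingAt_of_hodgeConjectureFor
    (HodgeConjectureFor.of_isIsogenous hAB (hodgeConjectureFor_of_HC_CM_of_cmSpreadingAt hCM hF hB))

/-- **Row U on the CM-dense families THROUGH `A` suffices for `CMSpreadingAt A`** (row U restricted to
the Mumford–Tate families through the cell member, the atlas's column (c6)).
[cite: CharlesSchnell2014Notes, Prop. 11.3.11, §11.3.4 Cor. 44] -/
theorem cmSpreadingAt_of_uniformAlgebraicityOn_through {A : AbelianVariety ℂ}
    (hU : ∀ ⦃𝒳 S : SchemeOver ℂ⦄ (f : 𝒳 ⟶ S) (s₁ : ComplexPoints S), Nonempty (A.X ≅ fiberOver f s₁) →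
      IsSmoothProjectiveFamily f A.dim → IsQuasiProjectiveOver 𝒳 → IsQuasiProjectiveOver S →
      IrreducibleSpace S.left → AlgebraicGeometry.Smooth S.hom →
      (∀ s : ComplexPoints S, ∃ A' : AbelianVariety ℂ, A'.dim = A.dim ∧ Nonempty (A'.X ≅ fiberOver f s)) →
      Dense (cmLocus f A.dim) → UniformAlgebraicityOn f A.dim) :
    CMSpreadingAt A :=
  fun _ _ f s₁ he hf h𝒳 hS hirr hsm hab hD =>
    cmSpreadingTo_of_uniformAlgebraicityOn hD (hU f s₁ he hf h𝒳 hS hirr hsm hab hD) s₁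

/-- **(1.1) on the CM-dense families through `A` suffices for `CMSpreadingAt A`** (density supplies the
CM fibre that feeds (1.1)). [cite: Abdulali1994FamiliesAV, (1.1), Lemma 6.2] -/
theorem cmSpreadingAt_of_invariantCycles_through {A : AbelianVariety ℂ}
    (hIC : ∀ ⦃𝒳 S : SchemeOver ℂ⦄ (f : 𝒳 ⟶ S) (s₁ : ComplexPoints S), Nonempty (A.X ≅ fiberOver f s₁) →
      IsSmoothProjectiveFamily f A.dim → Dense (cmLocus f A.dim) → InvariantCyclesHoldFor f A.dim) :
    CMSpreadingAt A := by
  intro 𝒳 S f s₁ he hf _ _ _ _ _ hD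
  haveI : Nonempty (ComplexPoints S) := ⟨s₁⟩
  exact cmSpreadingTo_of_invariantCyclesHoldFor (hIC f s₁ he hf hD) hD.nonempty s₁

/-- **Row U (global) gives the localised input at every variety.** [cite: CharlesSchnell2014Notes, Prop. 11.3.11] -/
theorem cmSpreadingAt_of_uniformAlgebraicityAtCMPoints (hU : UniformAlgebraicityAtCMPoints)
    (A : AbelianVariety ℂ) : CMSpreadingAt A :=
  cmSpreadingAt_of_uniformAlgebraicityOn_through fun _ _ _ _ _ hf h𝒳 hS hirr hsm hab hD =>
    uniformAlgebraicityOn_of_uniformAlgebraicityAtCMPoints hU hf h𝒳 hS hirr hsm hab hD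

/-- **Conversely the localised input at every variety gives row U**: every fibre of a U-admissible
family is charted by some abelian variety `A'` (binder of row U), and `CMSpreadingAt A'` at that fibre is
the required algebraicity; then §B. NO hypothesis. [folklore] -/
theorem uniformAlgebraicityAtCMPoints_of_forall_cmSpreadingAt
    (h : ∀ A : AbelianVariety ℂ, CMSpreadingAt A) : UniformAlgebraicityAtCMPoints := by
  intro n 𝒳 S f hf h𝒳 hS hirr hsm hab hD
  refine uniformAlgebraicityOn_of_forall_cmSpreadingTo fun s₁ => ?_
  obtain ⟨A', hdim, he⟩ := hab s₁
  subst hdim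
  exact h A' f s₁ he hf h𝒳 hS hirr hsm hab hD

/-- **ROW U IS LOCAL IN THE VARIETY: `UniformAlgebraicityAtCMPoints ↔ ∀ A, CMSpreadingAt A`**, with no
hypothesis at all. Consequently row U distributes over any cover of the class of abelian varieties by
cells (§D): the atlas may account for the deformation input cell by cell without loss.
[cite: CharlesSchnell2014Notes, Prop. 11.3.11, Thm. 11.3.2] -/
theorem uniformAlgebraicityAtCMPoints_iff_forall_cmSpreadingAt :
    UniformAlgebraicityAtCMPoints ↔ ∀ A : AbelianVariety ℂ, CMSpreadingAt A :=
  ⟨cmSpreadingAt_of_uniformAlgebraicityAtCMPoints,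
    uniformAlgebraicityAtCMPoints_of_forall_cmSpreadingAt⟩

/-! ## §D — Per class: the atlas service (`HCOnClass 𝒞` spelled out as `∀ A, 𝒞 A → HC A`) -/
/-- **On path, per class, unconditionally: `HCOnClass 𝒞 → CMSpreadingOn 𝒞`.** [cite: Deligne2000, §1] -/
theorem cmSpreadingOn_of_hcOnClass (𝒞 : AbelianVariety ℂ → Prop)
    (h : ∀ A : AbelianVariety ℂ, 𝒞 A → HodgeConjectureFor A.dim A.X) :
    ∀ A : AbelianVariety ℂ, 𝒞 A → CMSpreadingAt A :=
  fun A hA => cmSpreadingAt_of_hodgeConjectureFor (h A hA)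

/-- **The conditional theorem per class: `HC_CM → #20 → CMSpreadingOn 𝒞 → HCOnClass 𝒞`** — the
kernel form `HC_<class>_of_HC_CM_and_<input>` asked of this axis, for EVERY class at once.
[cite: Deligne1982HodgeCycles, §6 Prop. 6.1] [cite: CharlesSchnell2014Notes, Thm. 11.5.11] -/
theorem hcOnClass_of_HC_CM_of_cmSpreadingOn (hCM : RankFourFaces.CMAbelianHodge)
    (hF : deligne1982_cmDenseMumfordTateFamilies) (𝒞 : AbelianVariety ℂ → Prop)
    (h : ∀ A : AbelianVariety ℂ, 𝒞 A → CMSpreadingAt A) :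
    ∀ A : AbelianVariety ℂ, 𝒞 A → HodgeConjectureFor A.dim A.X :=
  fun A hA => hodgeConjectureFor_of_HC_CM_of_cmSpreadingAt hCM hF (h A hA)

/-- **EXACTNESS per class modulo `HC_CM` and #20: `HCOnClass 𝒞 ↔ CMSpreadingOn 𝒞`** — the atlas
columns (c6)/(c7) for every cell `𝒞` cite this one declaration.
[cite: Deligne1982HodgeCycles, §6 Prop. 6.1] [cite: CharlesSchnell2014Notes, Thm. 11.5.11, Prop. 11.3.11] -/
theorem hcOnClass_iff_cmSpreadingOn_of_HC_CM (hCM : RankFourFaces.CMAbelianHodge)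
    (hF : deligne1982_cmDenseMumfordTateFamilies) (𝒞 : AbelianVariety ℂ → Prop) :
    (∀ A : AbelianVariety ℂ, 𝒞 A → HodgeConjectureFor A.dim A.X) ↔
      ∀ A : AbelianVariety ℂ, 𝒞 A → CMSpreadingAt A :=
  ⟨cmSpreadingOn_of_hcOnClass 𝒞, hcOnClass_of_HC_CM_of_cmSpreadingOn hCM hF 𝒞⟩

/-- **Dimension rows** (`𝒞 = {A | A.dim = g}`, typer 1's `HCAtDim g`): mod `HC_CM` + #20, `HC` in
dimension `g` is exactly the localised input in dimension `g`. [cite: CharlesSchnell2014Notes, Thm. 11.5.11] -/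
theorem hcAtDim_iff_cmSpreadingAtDim_of_HC_CM (hCM : RankFourFaces.CMAbelianHodge)
    (hF : deligne1982_cmDenseMumfordTateFamilies) (g : ℕ) :
    (∀ A : AbelianVariety ℂ, A.dim = g → HodgeConjectureFor A.dim A.X) ↔
      ∀ A : AbelianVariety ℂ, A.dim = g → CMSpreadingAt A :=
  hcOnClass_iff_cmSpreadingOn_of_HC_CM hCM hF _

/-- **Only the non-CM members of a cell carry input** (the CM members are free, §C), unconditionally.
[cite: Milne1999, §7 (H)] -/
theorem cmSpreadingOn_iff_nonCM (𝒞 : AbelianVariety ℂ → Prop) :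
    (∀ A : AbelianVariety ℂ, 𝒞 A → CMSpreadingAt A) ↔
      ∀ A : AbelianVariety ℂ, 𝒞 A → ¬ IsOfCMType A → CMSpreadingAt A :=
  ⟨fun h A hA _ => h A hA, fun h A hA => by
    by_cases hcm : IsOfCMType A
    · exact cmSpreadingAt_of_isOfCMType hcm
    · exact h A hA hcm⟩

/-- **EXACT WITHOUT THE BINDER once the CM column is adjoined: `HCOnClass (𝒞 ∪ CM) ↔ HC_CM ∧
CMSpreadingOn 𝒞`** (mod #20). The two conjuncts are the atlas's two columns: `HC_CM` (by definition the
CM column) and the localised deformation input on the cell.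
[cite: Deligne1982HodgeCycles, §6 Prop. 6.1] [cite: Milne1999, §7 (H)] -/
theorem hcOnClass_or_cm_iff_HC_CM_and_cmSpreadingOn (hF : deligne1982_cmDenseMumfordTateFamilies)
    (𝒞 : AbelianVariety ℂ → Prop) :
    (∀ A : AbelianVariety ℂ, (𝒞 A ∨ IsOfCMType A) → HodgeConjectureFor A.dim A.X) ↔
      RankFourFaces.CMAbelianHodge ∧ ∀ A : AbelianVariety ℂ, 𝒞 A → CMSpreadingAt A :=
  ⟨fun h => ⟨fun A _ hA => h A (Or.inr hA),
      fun A hA => cmSpreadingAt_of_hodgeConjectureFor (h A (Or.inl hA))⟩,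
    fun h A hA => hA.elim (fun h𝒞 => hodgeConjectureFor_of_HC_CM_of_cmSpreadingAt h.1 hF (h.2 A h𝒞))
      fun hcm => h.1 A (AbelianVariety.isSmoothProjective_holds (A := A)) hcm⟩

/-- **Row U distributes over any cover by cells**: if every abelian variety lies in some cell `𝒟 i`,
then `U ↔ ∀ i, CMSpreadingOn (𝒟 i)` — NO hypothesis. This is what licenses the atlas to book the
deformation input per cell. [cite: CharlesSchnell2014Notes, Prop. 11.3.11] -/
theorem uniformAlgebraicityAtCMPoints_iff_forall_cells {ι : Sort*} (𝒟 : ι → AbelianVariety ℂ → Prop)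
    (hcov : ∀ A : AbelianVariety ℂ, ∃ i, 𝒟 i A) :
    UniformAlgebraicityAtCMPoints ↔ ∀ (i) (A : AbelianVariety ℂ), 𝒟 i A → CMSpreadingAt A := by
  rw [uniformAlgebraicityAtCMPoints_iff_forall_cmSpreadingAt]
  exact ⟨fun h _ A _ => h A, fun h A => by obtain ⟨i, hi⟩ := hcov A; exact h i A hi⟩

/-- **`HC_AV` re-derived through the localisation: `HC_AV ↔ HC_CM ∧ ∀ A, CMSpreadingAt A`** (mod #20),
consistent with part III's `HC_AV ↔ HC_CM ∧ U` via §C. `HC_AV` = item 1333's decl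
`Theses.PadicSemiregularLift.HodgeAbelianVarieties`. [cite: Deligne1982HodgeCycles, §6 Prop. 6.1]
[cite: CharlesSchnell2014Notes, Thm. 11.5.11] -/
theorem HC_AV_iff_HC_CM_and_forall_cmSpreadingAt (hF : deligne1982_cmDenseMumfordTateFamilies) :
    PadicSemiregularLift.HodgeAbelianVarieties ↔
      RankFourFaces.CMAbelianHodge ∧ ∀ A : AbelianVariety ℂ, CMSpreadingAt A :=
  ⟨fun h => ⟨HC_CM_of_HC_AV h, fun A => cmSpreadingAt_of_hodgeConjectureFor (h A)⟩,
    fun h A => hodgeConjectureFor_of_HC_CM_of_cmSpreadingAt h.1 hF (h.2 A)⟩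

/-- **The item this seat supports, read through the localisation: `CMToAbelian ↔ (HC_CM → ∀ A,
CMSpreadingAt A)`** (mod #20; item `stmt-HodgeConjecture-16267` = `Theses.RankFourFaces.CMToAbelian`).
[cite: Deligne1982HodgeCycles, §6 Prop. 6.1] [cite: CharlesSchnell2014Notes, Thm. 11.5.11] -/
theorem cmToAbelian_iff_HC_CM_imp_forall_cmSpreadingAt (hF : deligne1982_cmDenseMumfordTateFamilies) :
    RankFourFaces.CMToAbelian ↔
      (RankFourFaces.CMAbelianHodge → ∀ A : AbelianVariety ℂ, CMSpreadingAt A) :=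
  ⟨fun h hCM A => cmSpreadingAt_of_hodgeConjectureFor
      (h hCM A (AbelianVariety.isSmoothProjective_holds (A := A))),
    fun h hCM A _ => hodgeConjectureFor_of_HC_CM_of_cmSpreadingAt hCM hF (h hCM A)⟩

/-! ## §E — Ledger: the localised deformation axis in one statement -/
/-- **THE LOCALISED DEFORMATION AXIS** (mod Deligne's fact #20; `HC_CM` a binder where it appears):
(1) row U is local — `U ↔ ∀ A, CMSpreadingAt A` (no hypothesis); (2) `HC_AV ↔ HC_CM ∧ ∀ A,
CMSpreadingAt A`; (3) for every class `𝒞`, `HC_CM → (HCOnClass 𝒞 ↔ CMSpreadingOn 𝒞)`; (4) the CM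
column, the `B = D` column and `dim ≤ 3` carry no deformation input. Honest framing: research route
conditional on `HC_CM`; not a corollary; Q11.4-sentence-2 already refuted in dim ≥ 3.
[cite: Deligne1982HodgeCycles, Thm. 2.11, §6 Prop. 6.1] [cite: CharlesSchnell2014Notes, Thm. 11.5.11, Prop. 11.3.11]
[cite: vanGeemen1994HodgeAV, §2.4] [cite: Milne1999, §7 (H)] -/
theorem deformAxis_localised (hF : deligne1982_cmDenseMumfordTateFamilies) :
    (UniformAlgebraicityAtCMPoints ↔ ∀ A : AbelianVariety ℂ, CMSpreadingAt A) ∧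
    (PadicSemiregularLift.HodgeAbelianVarieties ↔
      RankFourFaces.CMAbelianHodge ∧ ∀ A : AbelianVariety ℂ, CMSpreadingAt A) ∧
    (∀ 𝒞 : AbelianVariety ℂ → Prop, RankFourFaces.CMAbelianHodge →
      ((∀ A, 𝒞 A → HodgeConjectureFor A.dim A.X) ↔ ∀ A, 𝒞 A → CMSpreadingAt A)) ∧
    (∀ A : AbelianVariety ℂ, IsOfCMType A → CMSpreadingAt A) ∧
    (∀ A : AbelianVariety ℂ, IsDivisorGenerated A → CMSpreadingAt A) ∧
    (∀ A : AbelianVariety ℂ, A.dim ≤ 3 → CMSpreadingAt A) :=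
  ⟨uniformAlgebraicityAtCMPoints_iff_forall_cmSpreadingAt, HC_AV_iff_HC_CM_and_forall_cmSpreadingAt hF,
    fun 𝒞 hCM => hcOnClass_iff_cmSpreadingOn_of_HC_CM hCM hF 𝒞, fun _ => cmSpreadingAt_of_isOfCMType,
    fun _ => cmSpreadingAt_of_isDivisorGenerated, fun _ => cmSpreadingAt_of_dim_le_three⟩

end Summit.HodgeConjecture.HodgeConjecture.Ring2.Deform

end
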